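import Summits.QuantumFields.BalabanUV.Beta.WilsonFluctuationWard22Trace
import Summits.QuantumFields.BalabanUV.Beta.ColourBasisSU

/-!
# `BalabanUV.Beta.WilsonBiStencilGaugeLegZ` — THE FLUCTUATION-LEG PURE-GAUGE LAW OF an3's WILSON BI-STENCIL ON `ℤ^{d+1}`: `wilsonW₂ d (wsym22 N)` with
# colour data, and the dictionary's table `T₂ := wilsonW₂ d ((8N²)⁻¹ • wsym22 N)` COLOUR-FREE (`2 ≤ N`) (file (R3) of the kernel route to the torus row
# `torus_a2_wilson`; D1 formalisation swarm seat `b2b-balaban-beta-d1-formalise-leaf-05`, gen 35)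

HONEST FRAMING (cell charter, verbatim): «discharging `BetaPertH` makes Bałaban's UV stability UNCONDITIONAL — a real
constructive-QFT result; it is NOT the continuum limit and NOT the Clay problem.»  HONEST DEPENDENCY (cell records, verbatim):
«continuum YM on T⁴ ⇐ BetaPertH ∧ nine spine estimates (0/9 proved); BetaPertH ⇐ (D1) ∧ (D4) ∧ CAP+tail; G-an2-4 gates asym, D1 and
NE2/3/4.»  DERIVED cell leaf: [folklore] finite algebra, no estimate, no limit, nothing cited — every statement is kernel-proved here; no
`[cite:]` tag, no `def`, no `def … : Prop` (the finite window of the transfer is a local `set` inside the one proof that uses it).  By itself this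
file instantiates NO binder of the β-function wall and NO row of the door.  NOT D1, NOT `BetaPertH`, NOT continuum, NOT Clay.  «not in print; our bookkeeping».
ABSOLUTE RULE (cell charter, verbatim): «No internally-minted statement may enter as a cited fact. Every hypothesis is either
kernel-proved in this package or a verbatim quotation of a PUBLISHED theorem with page reference. The manuscript(s) under audit are
NOT citable for their own disputed steps — they are the thing under adjudication; programme-internal (2001/route/tribunal) claims are
never citable.»

## What

(R2c) `WilsonFluctuationWard22Trace.flucWard22_traced_gaugeLeg` is the law on every FINITE lattice.  §1–§2 pull it back to `ℤ^{d+1}` along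
leaf-05-g2's `WilsonStencilTransport.castVec`, injective on the finite window of sites that occur (leaf-09's `bondPairTab_map`,
leaf-05-g2's `S₀A_map` ∕ `Lc_map`; the pattern of `WilsonBiStencilWardZ.wEntry₂_wsym22_div_Z` and of gan24-leaf-02's `GAN24.WilsonGaugeLegContact`):
**`wEntry₂_wsym22_gaugeLeg_Z`**.  §3 reads it in the tree's currency — `wilsonW₂ … (inl α) (inl γ) = wEntry₂` (`rfl`), an2's `wilsonA` field block
(`WilsonReflectionContact.wilsonA_inl_inl`), `d*d = curvAdj ∘ curv` (`curvAdj_curv_delta1_eq_two_mul_Lc`, `BorderedHessianSymmetry.curvAdj_curv_delta1_symm`):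
**`gaugeLeg_wilsonW₂_wsym22_inl_inl`** (colour data kept: `τ` complete and tr-orthonormal, `N ≠ 0`, a colour `c`), and COLOUR-FREE for `SU(N)`, `2 ≤ N`
(an3's `ColourBasisSU.suGen`, the table factor `(8N²)⁻¹` pulled through `wEntry₂_smul`) — the dictionary's order-2 Wilson table `T₂ := wilsonW₂ d ((8N²)⁻¹ • wsym22 N)`:

  **`gaugeLeg_wilsonT2_inl_inl`**: for every `d`, `2 ≤ N`, index bonds `(κ, u)`, `(κ′, u′)`, first leg `(x, α)`, varied site `y`,
  `Σ_γ (T₂ κ u κ′ u′ x (y − e_γ) (inl α) (inl γ) − T₂ κ u κ′ u′ x y (inl α) (inl γ))`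
  `  = −½·([u′ + e_κ′ = y]·wilsonA d κ u x u′ (inl α) (inl κ′) + [u + e_κ = y]·wilsonA d κ′ u′ x u (inl α) (inl κ))`
  `    − ¼·[u = u′ ∧ κ = κ′]·[u + e_κ = y]·(d*d δ_{(κ,u)})_α(x)`
  `    + ⅛·[x + e_α = y]·([x = u′ ∧ α = κ′]·(d*d δ_{(κ,u)})_α(x) + [x = u ∧ α = κ]·(d*d δ_{(κ′,u′)})_α(x))`

— the response of the second-order Wilson table to the pure-gauge FLUCTUATION `d(δ_y)` on its SECOND TABLE LEG: the FIRST-order table with its second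
leg AT THE OTHER INDEX BOND, weighted at that bond's TIP (coefficient `−½`); a same-bond contact (`−¼`, tip) and an index-bond-equals-leg contact
(`+⅛`, tip of the leg) against `d*d`.  Side by side with an2's INDEX-bond laws `CombWilsonT2GaugeLetter.divV_wilsonT2_fst∕snd_inl_inl` (`½`, SITE rule)
and gan24-leaf-02's first-order leg law `GAN24.WilsonGaugeLegContact.gaugeLeg_wilsonA_inl_inl` (`½` tip − `¼` ends).  An independent first-principles
check (exact 4-jets of `Σ rntr(plaquette words)`, `su(2)`∕`su(3)`, `D = 2, 3`; 822 configurations, residual ≤ 8·10⁻¹⁶) of exactly these three constants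
is archived in the cell (`HOME/b2b-balaban-beta-d1-formalise-leaf-05/g35/engine/`); the kernel proof below does not use it.
NOT HERE ((R4)): the torus periodisation and U21's row `a2`.
Provenance: pub-balaban β sub-cell, D1 formalisation swarm, unit `b2b-balaban-beta-d1-formalise-leaf-05` gen 35, 2026-08-23 (v1); over (R2c) and the
files named above BY NAME; no existing file touched.
-/

namespace Summit.QuantumFields.BalabanUV.Beta.WilsonBiStencilGaugeLegZ

open Finset
open scoped BigOperators Matrix
open Literature.MathematicalPhysics.QuantumFieldTheory.Balaban1983to89
open Literature.MathematicalPhysics.QuantumFieldTheory.Balaban1983to89.Beta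
open ColourTrace (Complete TrOrthonormal)
open PlaquetteStencilData (WilsonIdx wα wβ)
open PlaquetteVertex2Stencil (off)
open WilsonVertex2Kron (bondPairTab)
open WilsonVertex2Sym (wsym22)
open WilsonBiStencil (wEntry₂ wilsonW₂ wilsonW₂_inl_inl wEntry₂_smul)
open StepJetData (wilsonA)
open OneStepResolventKernel (Fib)
open B6BondElimination (unitVec)
open AffineAveraging (curv curvAdj)
open KKTFluctuationKernel (delta1)
open Summit.QuantumFields.BalabanUV.Beta.WilsonReflectionFrame (Lc S₀A)
open Summit.QuantumFields.BalabanUV.Beta.WilsonStencilTransport (castVec castVec_injOn S₀A_map Lc_map)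
open Summit.QuantumFields.BalabanUV.Beta.WilsonReflectionContact (wilsonA_inl_inl curvAdj_curv_delta1_eq_two_mul_Lc)
open Summit.QuantumFields.BalabanUV.Beta.BorderedHessian (curvAdj_curv_delta1_symm)
open Summit.QuantumFields.BalabanUV.Beta.WilsonBiStencilWardZ (bondPairTab_map)
open Summit.QuantumFields.BalabanUV.Beta.WilsonFluctuationWard22Trace (flucWard22_traced_gaugeLeg)
open Summit.QuantumFields.BalabanUV.Beta.ColourBasisSU (suGen suGen_complete suGen_trOrthonormal diagIndex ne_zero_of_two_le)

/-! ## §1 The law on `ℤ^{d+1}` with colour data (the finite window of the transfer is local to the proof) -/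

section Transfer

variable {d : ℕ} {N : ℕ} {C : Type*} [Fintype C] [DecidableEq C] {τ : C → Matrix (Fin N) (Fin N) ℂ}

open scoped Matrix.Norms.Operator in
/-- [folklore] **THE FLUCTUATION-LEG LAW OF `wEntry₂ d (wsym22 N)` ON `ℤ^{d+1}`** (frame `unitVec`; the torus law `flucWard22_traced_gaugeLeg` on
`(ZMod M)^{d+1}` pulled back along `castVec M`, `M` one more than the spread of the finite window of sites that occur — those sites and the two tips, the
shifted sites `y − e_γ`, the plaquette points `u′ − off k + off l`, the first-order supports of both index bonds, the `Lc` supports of both): first index bond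
`(κ′, u′)`, second `(κ, u)`, first leg `(x, α)`, the second leg varied at `y`. -/
theorem wEntry₂_wsym22_gaugeLeg_Z (hτ : Complete τ) (ho : TrOrthonormal τ) (hN : N ≠ 0) (c : C)
    (κ' : Fin (d + 1)) (u' : Fin (d + 1) → ℤ) (κ : Fin (d + 1)) (u x : Fin (d + 1) → ℤ) (α : Fin (d + 1)) (y : Fin (d + 1) → ℤ) :
    ∑ γ : Fin (d + 1), (wEntry₂ d (wsym22 N) κ' u' κ u x y α γ - wEntry₂ d (wsym22 N) κ' u' κ u x (y - unitVec γ) α γ) =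
      4 * (N : ℝ) ^ 2 * ((if u + unitVec κ = y then (1 : ℝ) else 0) * S₀A unitVec u' κ' (x, α) (u, κ)
          + (if u' + unitVec κ' = y then (1 : ℝ) else 0) * S₀A unitVec u κ (x, α) (u', κ'))
      + 2 * (N : ℝ) ^ 2 * ((if u = u' ∧ κ = κ' then (1 : ℝ) else 0)
          * ((if u + unitVec κ = y then (1 : ℝ) else 0) + (if u' + unitVec κ' = y then (1 : ℝ) else 0)) * Lc unitVec κ u (x, α))
      - 2 * (N : ℝ) ^ 2 * ((if x = u ∧ α = κ then (1 : ℝ) else 0) * (if u + unitVec κ = y then (1 : ℝ) else 0) * Lc unitVec κ' u' (x, α)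
          + (if x = u' ∧ α = κ' then (1 : ℝ) else 0) * (if u' + unitVec κ' = y then (1 : ℝ) else 0) * Lc unitVec κ u (x, α)) := by
  -- the finite window of the transfer
  let pts : ((Fin 6 ⊕ Fin (d + 1)) ⊕ ((Fin (d + 1) × Fin (d + 1) × Fin 4 × Fin 4) ⊕ (Fin 4 × WilsonIdx (Fin (d + 1)))))
      ⊕ ((Fin 4 × Fin (d + 1)) ⊕ (Fin 2 × Fin (d + 1) × Fin (d + 1))) → (Fin (d + 1) → ℤ) := fun i =>
    match i with
    | Sum.inl (Sum.inl (Sum.inl (0 : Fin 6))) => x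
    | Sum.inl (Sum.inl (Sum.inl (1 : Fin 6))) => y
    | Sum.inl (Sum.inl (Sum.inl (2 : Fin 6))) => u
    | Sum.inl (Sum.inl (Sum.inl (3 : Fin 6))) => u'
    | Sum.inl (Sum.inl (Sum.inl (4 : Fin 6))) => u + unitVec κ
    | Sum.inl (Sum.inl (Sum.inl (5 : Fin 6))) => u' + unitVec κ'
    | Sum.inl (Sum.inl (Sum.inr γ)) => y - unitVec γ
    | Sum.inl (Sum.inr (Sum.inl (μ, ν, k, l))) => u' - off unitVec μ ν k + off unitVec μ ν l
    | Sum.inl (Sum.inr (Sum.inr ((0 : Fin 4), i))) => u' + wα unitVec κ' i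
    | Sum.inl (Sum.inr (Sum.inr ((1 : Fin 4), i))) => u' + wβ unitVec κ' i
    | Sum.inl (Sum.inr (Sum.inr ((2 : Fin 4), i))) => u + wα unitVec κ i
    | Sum.inl (Sum.inr (Sum.inr ((3 : Fin 4), i))) => u + wβ unitVec κ i
    | Sum.inr (Sum.inl ((0 : Fin 4), ν)) => u - unitVec ν
    | Sum.inr (Sum.inl ((1 : Fin 4), μ)) => u + unitVec μ
    | Sum.inr (Sum.inl ((2 : Fin 4), ν)) => u' - unitVec ν
    | Sum.inr (Sum.inl ((3 : Fin 4), μ)) => u' + unitVec μ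
    | Sum.inr (Sum.inr ((0 : Fin 2), ν, μ)) => u - unitVec ν + unitVec μ
    | Sum.inr (Sum.inr ((1 : Fin 2), ν, μ)) => u' - unitVec ν + unitVec μ
  set M : ℕ := (∑ i, ∑ i', ∑ j, (pts i j - pts i' j).natAbs) + 1 with hM
  have hS : Set.InjOn (castVec M) (Set.range pts) := castVec_injOn pts
  have key := flucWard22_traced_gaugeLeg (Λ := Fin (d + 1) → ZMod M) hτ ho hN c (⇑(castVec M) ∘ unitVec) (castVec M y) (castVec M x) α
    (castVec M u) κ (castVec M u') κ'
  have mx : x ∈ Set.range pts := ⟨Sum.inl (Sum.inl (Sum.inl (0 : Fin 6))), rfl⟩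
  have my : y ∈ Set.range pts := ⟨Sum.inl (Sum.inl (Sum.inl (1 : Fin 6))), rfl⟩
  have mu : u ∈ Set.range pts := ⟨Sum.inl (Sum.inl (Sum.inl (2 : Fin 6))), rfl⟩
  have mu' : u' ∈ Set.range pts := ⟨Sum.inl (Sum.inl (Sum.inl (3 : Fin 6))), rfl⟩
  have mt : u + unitVec κ ∈ Set.range pts := ⟨Sum.inl (Sum.inl (Sum.inl (4 : Fin 6))), rfl⟩
  have mt' : u' + unitVec κ' ∈ Set.range pts := ⟨Sum.inl (Sum.inl (Sum.inl (5 : Fin 6))), rfl⟩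
  have myγ : ∀ γ, y - unitVec γ ∈ Set.range pts := fun γ => ⟨Sum.inl (Sum.inl (Sum.inr γ)), rfl⟩
  have m₁ : ∀ (μ ν : Fin (d + 1)) (k l : Fin 4), u' - off unitVec μ ν k + off unitVec μ ν l ∈ Set.range pts :=
    fun μ ν k l => ⟨Sum.inl (Sum.inr (Sum.inl (μ, ν, k, l))), rfl⟩
  have mα' : ∀ i, u' + wα unitVec κ' i ∈ Set.range pts := fun i => ⟨Sum.inl (Sum.inr (Sum.inr ((0 : Fin 4), i))), rfl⟩
  have mβ' : ∀ i, u' + wβ unitVec κ' i ∈ Set.range pts := fun i => ⟨Sum.inl (Sum.inr (Sum.inr ((1 : Fin 4), i))), rfl⟩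
  have mα : ∀ i, u + wα unitVec κ i ∈ Set.range pts := fun i => ⟨Sum.inl (Sum.inr (Sum.inr ((2 : Fin 4), i))), rfl⟩
  have mβ : ∀ i, u + wβ unitVec κ i ∈ Set.range pts := fun i => ⟨Sum.inl (Sum.inr (Sum.inr ((3 : Fin 4), i))), rfl⟩
  have l₁ : ∀ ν, u - unitVec ν ∈ Set.range pts := fun ν => ⟨Sum.inr (Sum.inl ((0 : Fin 4), ν)), rfl⟩
  have l₂ : ∀ μ, u + unitVec μ ∈ Set.range pts := fun μ => ⟨Sum.inr (Sum.inl ((1 : Fin 4), μ)), rfl⟩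
  have l₃ : ∀ ν μ, u - unitVec ν + unitVec μ ∈ Set.range pts := fun ν μ => ⟨Sum.inr (Sum.inr ((0 : Fin 2), ν, μ)), rfl⟩
  have l₁' : ∀ ν, u' - unitVec ν ∈ Set.range pts := fun ν => ⟨Sum.inr (Sum.inl ((2 : Fin 4), ν)), rfl⟩
  have l₂' : ∀ μ, u' + unitVec μ ∈ Set.range pts := fun μ => ⟨Sum.inr (Sum.inl ((3 : Fin 4), μ)), rfl⟩
  have l₃' : ∀ ν μ, u' - unitVec ν + unitVec μ ∈ Set.range pts := fun ν μ => ⟨Sum.inr (Sum.inr ((1 : Fin 2), ν, μ)), rfl⟩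
  have hsub : ∀ γ, castVec M y - (⇑(castVec M) ∘ unitVec) γ = castVec M (y - unitVec γ) := fun γ => by
    rw [Function.comp_apply, map_sub]
  have hadd : ∀ (v : Fin (d + 1) → ℤ) (γ : Fin (d + 1)), castVec M v + (⇑(castVec M) ∘ unitVec) γ = castVec M (v + unitVec γ) :=
    fun v γ => by rw [Function.comp_apply, map_add]
  have h₁ : ∀ γ, bondPairTab (⇑(castVec M) ∘ unitVec) (castVec M u') κ' (castVec M u) κ (wsym22 N) (castVec M x, α) (castVec M y, γ) =
      bondPairTab unitVec u' κ' u κ (wsym22 N) (x, α) (y, γ) :=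
    fun γ => bondPairTab_map _ hS unitVec u' κ' u κ _ mx my mu m₁ α γ
  have h₂ : ∀ γ, bondPairTab (⇑(castVec M) ∘ unitVec) (castVec M u') κ' (castVec M u) κ (wsym22 N) (castVec M x, α) (castVec M (y - unitVec γ), γ) =
      bondPairTab unitVec u' κ' u κ (wsym22 N) (x, α) (y - unitVec γ, γ) :=
    fun γ => bondPairTab_map _ hS unitVec u' κ' u κ _ mx (myγ γ) mu m₁ α γ
  have h₃ : S₀A (⇑(castVec M) ∘ unitVec) (castVec M u') κ' (castVec M x, α) (castVec M u, κ) = S₀A unitVec u' κ' (x, α) (u, κ) :=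
    S₀A_map _ hS unitVec u' κ' mx mu mα' mβ' α κ
  have h₄ : S₀A (⇑(castVec M) ∘ unitVec) (castVec M u) κ (castVec M x, α) (castVec M u', κ') = S₀A unitVec u κ (x, α) (u', κ') :=
    S₀A_map _ hS unitVec u κ mx mu' mα mβ α κ'
  have h₅ : Lc (⇑(castVec M) ∘ unitVec) κ (castVec M u) (castVec M x, α) = Lc unitVec κ u (x, α) := Lc_map _ hS unitVec κ u x α mx mu l₁ l₂ l₃
  have h₆ : Lc (⇑(castVec M) ∘ unitVec) κ' (castVec M u') (castVec M x, α) = Lc unitVec κ' u' (x, α) := Lc_map _ hS unitVec κ' u' x α mx mu' l₁' l₂' l₃'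
  simp only [hsub, hadd, h₁, h₂, h₃, h₄, h₅, h₆, hS.eq_iff mt my, hS.eq_iff mt' my, hS.eq_iff mu mu', hS.eq_iff mx mu, hS.eq_iff mx mu'] at key
  unfold wEntry₂
  exact key

end Transfer

/-! ## §2 The law in the tree's currency: `wilsonW₂`, an2's `wilsonA`, `d*d`; and colour-free for the dictionary's table -/

section Law

variable {d : ℕ} {N : ℕ}

/-- [folklore] `Lc` at the frame `unitVec` is half the `d*d` matrix entry, read with the index bond's delta: `Lc unitVec κ u (x, α) = ½·(d*d δ_{(κ,u)})_α(x)`. -/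
theorem Lc_eq_half_curvAdj_curv (κ : Fin (d + 1)) (u x : Fin (d + 1) → ℤ) (α : Fin (d + 1)) :
    Lc unitVec κ u (x, α) = (1 / 2 : ℝ) * curvAdj (curv (delta1 κ u)) α x := by
  rw [curvAdj_curv_delta1_symm, curvAdj_curv_delta1_eq_two_mul_Lc]
  ring

open scoped Matrix.Norms.Operator in
/-- [folklore] **THE FLUCTUATION-LEG LAW OF `wilsonW₂ d (wsym22 N)` ON `ℤ^{d+1}`, FIELD–FIELD ENTRIES, WITH COLOUR DATA**: index bonds `(κ, u)` (first),
`(κ′, u′)` (second), first leg `(x, α)`, second leg varied at `y`: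
`Σ_γ (W₂ κ u κ′ u′ x (y − e_γ) (inl α) (inl γ) − W₂ κ u κ′ u′ x y (inl α) (inl γ))`
`  = −4N²·([u′+e_κ′ = y]·wilsonA d κ u x u′ (inl α) (inl κ′) + [u+e_κ = y]·wilsonA d κ′ u′ x u (inl α) (inl κ))`
`    − 2N²·[u = u′ ∧ κ = κ′]·[u+e_κ = y]·(d*d δ_{(κ,u)})_α(x) + N²·[x+e_α = y]·([x = u′ ∧ α = κ′]·(d*d δ_{(κ,u)})_α(x) + [x = u ∧ α = κ]·(d*d δ_{(κ′,u′)})_α(x))`. -/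
theorem gaugeLeg_wilsonW₂_wsym22_inl_inl {C : Type*} [Fintype C] [DecidableEq C] {τ : C → Matrix (Fin N) (Fin N) ℂ} (hτ : Complete τ)
    (ho : TrOrthonormal τ) (hN : N ≠ 0) (c : C) (κ : Fin (d + 1)) (u : Fin (d + 1) → ℤ) (κ' : Fin (d + 1)) (u' x : Fin (d + 1) → ℤ)
    (α : Fin (d + 1)) (y : Fin (d + 1) → ℤ) :
    ∑ γ : Fin (d + 1), (wilsonW₂ d (wsym22 N) κ u κ' u' x (y - unitVec γ) (Sum.inl α) (Sum.inl γ) - wilsonW₂ d (wsym22 N) κ u κ' u' x y (Sum.inl α) (Sum.inl γ)) =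
      -(4 * (N : ℝ) ^ 2) * ((if u' + unitVec κ' = y then (1 : ℝ) else 0) * wilsonA d κ u x u' (Sum.inl α) (Sum.inl κ')
          + (if u + unitVec κ = y then (1 : ℝ) else 0) * wilsonA d κ' u' x u (Sum.inl α) (Sum.inl κ))
      - 2 * (N : ℝ) ^ 2 * ((if u = u' ∧ κ = κ' then (1 : ℝ) else 0) * (if u + unitVec κ = y then (1 : ℝ) else 0) * curvAdj (curv (delta1 κ u)) α x)
      + (N : ℝ) ^ 2 * (if x + unitVec α = y then (1 : ℝ) else 0)
          * ((if x = u' ∧ α = κ' then (1 : ℝ) else 0) * curvAdj (curv (delta1 κ u)) α x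
            + (if x = u ∧ α = κ then (1 : ℝ) else 0) * curvAdj (curv (delta1 κ' u')) α x) := by
  have h := wEntry₂_wsym22_gaugeLeg_Z hτ ho hN c κ u κ' u' x α y
  simp only [wilsonW₂_inl_inl, ← wilsonA_inl_inl, Lc_eq_half_curvAdj_curv] at h ⊢
  -- the law is the negative of (R2c)'s (order of the difference); the same-bond indicators merge; the bond-equals-leg tips read at the leg
  have e1 : ∑ γ : Fin (d + 1), (wEntry₂ d (wsym22 N) κ u κ' u' x (y - unitVec γ) α γ - wEntry₂ d (wsym22 N) κ u κ' u' x y α γ) =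
      -∑ γ : Fin (d + 1), (wEntry₂ d (wsym22 N) κ u κ' u' x y α γ - wEntry₂ d (wsym22 N) κ u κ' u' x (y - unitVec γ) α γ) := by
    rw [← Finset.sum_neg_distrib]; exact Finset.sum_congr rfl fun γ _ => by ring
  rw [e1, h]
  -- indicators: `[b′ = b] = [b = b′]`, `[b = b′]·[tip b′ = y] = [b = b′]·[tip b = y]`, `[b = b′]·d*d_{b′} = [b = b′]·d*d_b`,
  -- `[p = b]·[tip b = y] = [p = b]·[tip p = y]`
  have I0 : (if u' = u ∧ κ' = κ then (1 : ℝ) else 0) = (if u = u' ∧ κ = κ' then (1 : ℝ) else 0) := by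
    by_cases hb : u = u' ∧ κ = κ'
    · rw [if_pos hb, if_pos ⟨hb.1.symm, hb.2.symm⟩]
    · rw [if_neg hb, if_neg (fun h' => hb ⟨h'.1.symm, h'.2.symm⟩)]
  have I1 : (if u = u' ∧ κ = κ' then (1 : ℝ) else 0) * (if u' + unitVec κ' = y then (1 : ℝ) else 0) =
      (if u = u' ∧ κ = κ' then (1 : ℝ) else 0) * (if u + unitVec κ = y then (1 : ℝ) else 0) := by
    by_cases hb : u = u' ∧ κ = κ'
    · obtain ⟨rfl, rfl⟩ := hb; rfl
    · rw [if_neg hb, zero_mul, zero_mul]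
  have I4 : (if u = u' ∧ κ = κ' then (1 : ℝ) else 0) * curvAdj (curv (delta1 κ' u')) α x =
      (if u = u' ∧ κ = κ' then (1 : ℝ) else 0) * curvAdj (curv (delta1 κ u)) α x := by
    by_cases hb : u = u' ∧ κ = κ'
    · obtain ⟨rfl, rfl⟩ := hb; rfl
    · rw [if_neg hb, zero_mul, zero_mul]
  have I2 : (if x = u ∧ α = κ then (1 : ℝ) else 0) * (if u + unitVec κ = y then (1 : ℝ) else 0) =
      (if x = u ∧ α = κ then (1 : ℝ) else 0) * (if x + unitVec α = y then (1 : ℝ) else 0) := by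
    by_cases hb : x = u ∧ α = κ
    · obtain ⟨rfl, rfl⟩ := hb; rfl
    · rw [if_neg hb, zero_mul, zero_mul]
  have I3 : (if x = u' ∧ α = κ' then (1 : ℝ) else 0) * (if u' + unitVec κ' = y then (1 : ℝ) else 0) =
      (if x = u' ∧ α = κ' then (1 : ℝ) else 0) * (if x + unitVec α = y then (1 : ℝ) else 0) := by
    by_cases hb : x = u' ∧ α = κ'
    · obtain ⟨rfl, rfl⟩ := hb; rfl
    · rw [if_neg hb, zero_mul, zero_mul]
  rw [I0]
  linear_combination (-(N : ℝ) ^ 2 * curvAdj (curv (delta1 κ' u')) α x) * I1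
    + (-2 * (N : ℝ) ^ 2 * (if u + unitVec κ = y then (1 : ℝ) else 0)) * I4
    + ((N : ℝ) ^ 2 * curvAdj (curv (delta1 κ u)) α x) * I3 + ((N : ℝ) ^ 2 * curvAdj (curv (delta1 κ' u')) α x) * I2

/-- [folklore] the table constants: `(8N²)⁻¹·4N² = ½`, `(8N²)⁻¹·2N² = ¼`, `(8N²)⁻¹·N² = ⅛` (`N ≠ 0`). -/
theorem table_consts (hN : N ≠ 0) :
    (8 * (N : ℝ) ^ 2)⁻¹ * (4 * (N : ℝ) ^ 2) = 1 / 2 ∧ (8 * (N : ℝ) ^ 2)⁻¹ * (2 * (N : ℝ) ^ 2) = 1 / 4 ∧ (8 * (N : ℝ) ^ 2)⁻¹ * (N : ℝ) ^ 2 = 1 / 8 := by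
  have hN' : (N : ℝ) ≠ 0 := by exact_mod_cast hN
  refine ⟨?_, ?_, ?_⟩ <;> field_simp <;> ring

/-- [folklore] **THE FLUCTUATION-LEG PURE-GAUGE LAW OF THE DICTIONARY's ORDER-2 WILSON TABLE `T₂ := wilsonW₂ d ((8N²)⁻¹ • wsym22 N)`, COLOUR-FREE** (`SU(N)`,
`2 ≤ N`; see the module docstring): index bonds `(κ, u)`, `(κ′, u′)`, first leg `(x, α)`, second leg varied at `y`;
`Σ_γ (T₂ … x (y − e_γ) (inl α) (inl γ) − T₂ … x y (inl α) (inl γ)) = −½·([u′+e_κ′ = y]·wilsonA d κ u x u′ (inl α) (inl κ′) + [u+e_κ = y]·wilsonA d κ′ u′ x u (inl α) (inl κ))`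
`− ¼·[u = u′ ∧ κ = κ′]·[u+e_κ = y]·(d*d δ_{(κ,u)})_α(x) + ⅛·[x+e_α = y]·([x = u′ ∧ α = κ′]·(d*d δ_{(κ,u)})_α(x) + [x = u ∧ α = κ]·(d*d δ_{(κ′,u′)})_α(x))`. -/
theorem gaugeLeg_wilsonT2_inl_inl (hN : 2 ≤ N) (κ : Fin (d + 1)) (u : Fin (d + 1) → ℤ) (κ' : Fin (d + 1)) (u' x : Fin (d + 1) → ℤ)
    (α : Fin (d + 1)) (y : Fin (d + 1) → ℤ) :
    ∑ γ : Fin (d + 1), (wilsonW₂ d ((8 * (N : ℝ) ^ 2)⁻¹ • wsym22 N) κ u κ' u' x (y - unitVec γ) (Sum.inl α) (Sum.inl γ)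
        - wilsonW₂ d ((8 * (N : ℝ) ^ 2)⁻¹ • wsym22 N) κ u κ' u' x y (Sum.inl α) (Sum.inl γ)) =
      -(1 / 2 : ℝ) * ((if u' + unitVec κ' = y then (1 : ℝ) else 0) * wilsonA d κ u x u' (Sum.inl α) (Sum.inl κ')
          + (if u + unitVec κ = y then (1 : ℝ) else 0) * wilsonA d κ' u' x u (Sum.inl α) (Sum.inl κ))
      - (1 / 4 : ℝ) * ((if u = u' ∧ κ = κ' then (1 : ℝ) else 0) * (if u + unitVec κ = y then (1 : ℝ) else 0) * curvAdj (curv (delta1 κ u)) α x)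
      + (1 / 8 : ℝ) * (if x + unitVec α = y then (1 : ℝ) else 0)
          * ((if x = u' ∧ α = κ' then (1 : ℝ) else 0) * curvAdj (curv (delta1 κ u)) α x
            + (if x = u ∧ α = κ then (1 : ℝ) else 0) * curvAdj (curv (delta1 κ' u')) α x) := by
  have h0 : N ≠ 0 := ne_zero_of_two_le hN
  have h := gaugeLeg_wilsonW₂_wsym22_inl_inl (suGen_complete h0) (suGen_trOrthonormal N) h0 (diagIndex hN) κ u κ' u' x α y
  obtain ⟨c₁, c₂, c₃⟩ := table_consts (N := N) h0
  simp only [wilsonW₂_inl_inl, wEntry₂_smul] at h ⊢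
  have e : ∑ γ : Fin (d + 1), ((8 * (N : ℝ) ^ 2)⁻¹ * wEntry₂ d (wsym22 N) κ u κ' u' x (y - unitVec γ) α γ
        - (8 * (N : ℝ) ^ 2)⁻¹ * wEntry₂ d (wsym22 N) κ u κ' u' x y α γ) =
      (8 * (N : ℝ) ^ 2)⁻¹ * ∑ γ : Fin (d + 1), (wEntry₂ d (wsym22 N) κ u κ' u' x (y - unitVec γ) α γ - wEntry₂ d (wsym22 N) κ u κ' u' x y α γ) := by
    rw [Finset.mul_sum]; exact Finset.sum_congr rfl fun γ _ => by ring
  rw [e, h]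
  linear_combination (-((if u' + unitVec κ' = y then (1 : ℝ) else 0) * wilsonA d κ u x u' (Sum.inl α) (Sum.inl κ')
      + (if u + unitVec κ = y then (1 : ℝ) else 0) * wilsonA d κ' u' x u (Sum.inl α) (Sum.inl κ))) * c₁
    - ((if u = u' ∧ κ = κ' then (1 : ℝ) else 0) * (if u + unitVec κ = y then (1 : ℝ) else 0) * curvAdj (curv (delta1 κ u)) α x) * c₂
    + ((if x + unitVec α = y then (1 : ℝ) else 0) * ((if x = u' ∧ α = κ' then (1 : ℝ) else 0) * curvAdj (curv (delta1 κ u)) α x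
        + (if x = u ∧ α = κ then (1 : ℝ) else 0) * curvAdj (curv (delta1 κ' u')) α x)) * c₃

end Law

end Summit.QuantumFields.BalabanUV.Beta.WilsonBiStencilGaugeLegZ
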